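import Literature.AlgebraicGeometry.ShimuraVarieties.UnitaryShimuraCanonicalModelPrinted
import Literature.AlgebraicGeometry.ShimuraVarieties.UnitaryShimuraCanonicalModelPrintedForm
import Literature.NumberTheory.ComplexMultiplication.ComplexReflexField
import Literature.AlgebraicGeometry.ShimuraVarieties.UnitaryAuxiliaryTorusDatum
import Literature.AlgebraicGeometry.ShimuraVarieties.UnitaryAuxiliaryTorusClassNumber
import Literature.AlgebraicGeometry.ShimuraVarieties.UnitaryAuxiliaryReflexBookkeeping
import Literature.AlgebraicGeometry.ShimuraVarieties.UnitaryCanonicalDescentPredicates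
import Literature.AlgebraicGeometry.ShimuraVarieties.UnitaryCanonicalDescentTower
import HarnessLib

/-!
# Line `a1-reflex-compositum`, stub (A) `stub_reflexCompositumModel` — ASSEMBLY from the Galois-leg descent over `E♯`
# (binder `hDel` → `HypDel`; cell hodgecm-mathlib, fan A, rung A-I, KEY a1-reflex-compositum-model, seat A-p05)

Skeleton of record: `A-plan/lines/a1-reflex-compositum.lean` sha16 785cc48e2d31c68c (namespace
`Summit.HodgeConjecture.CorCM.Cruxes.HypDel.ReflexCompositum`; stub (A) text :88–:112 copied VERBATIM below as the conclusion of
`stub_reflexCompositumModel_of_galoisLegOver`).  HC_CM is proved only modulo the 7 printed citations (`hDel`, `h21`, `hLiu418`,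
`h411`, `h413`, `hD3`, `hD1''`) until rung 0 closes; this file asserts nothing printed: its inputs are HYPOTHESES.

WHAT IS PROVED.  `stub_reflexCompositumModel_of_galoisLegOver hGL hg5 hg6 : <stub (A)>` where
* `hGL` = the Galois-leg descent OVER `E♯` in L-idèle convention for ALL CM fields `L` and ALL adapted `Φ` — VERBATIM the
  conclusion of B-plan2's `galoisLegDescentOver_general_of_F1 hA hN hker hF1` (B1HeckeQuotientDescent v7 :856; its inputs:
  F1 = `Aux.canonicalModel_exists_printed` (named fact p591128), (a′) = tree `Aux.artinSurjectiveReflex` (p594845), (d′) = tree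
  `UnitaryCanonicalModel.kernelTwistInvariance` (p594589), (b′) `StubArtinNormFunctorial` (B-p16), and the PROVED finite Hecke
  quotient (5.11.1) — Q/B/Torsor stubs all closed in the tree);
* `hg5 : Aux.finite_classGroup_printed` (named fact p594393, [BorelIHES1963] Thm. 5.1 for `T₀`);
* `hg6` = existence of an open compact level `L₀ ≤ T₀(𝔸_f)` (B-p01's `Aux.unitLevel`, a definition; instantiate `hg6 := fun L _ _ _ => ⟨Aux.unitLevel L⟩`).
Proof = A-side bookkeeping only: choose `Φ` adapted (`Aux.exists_isAdapted`), `L₀` (hg6) with finite class group (hg5), take the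
`E♯`-form from `hGL`, embed `E♯ ↪ E` under `ιE` (`Aux.exists_ringHom_reflexField`: `τ(L) ⊆ ιE(E) ⊇ E*(Φ)`), and base-change up the
tower (`IsCanonicalDescentOver.tower`, p595741).  So stub (A) — hence `hDel♭` via the skeleton's PROVED
`galoisCase_of_reflexCompositumModel`, and `hDel` modulo the TIER-G residual `stub_reflexDescent` — rests on exactly:
F1 + g5 + (b′) (+ the definition g6).

References: [Deligne1979ShimuraVarieties] 2.2.5, 2.3.1; [Deligne1971TravauxShimura] Prop. 5.11, Cor. 5.7;
[Milne2005ShimuraVarieties] Def. 12.8 (62); [Liu2021] App. C Lem. C.14, Rem. C.15; [BorelIHES1963] Thm. 5.1.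
-/

set_option autoImplicit false

noncomputable section

open Function MulAction NumberField IsDedekindDomain CategoryTheory CategoryTheory.Limits Matrix
  AlgebraicGeometry
open scoped Matrix ComplexOrder
open Literature.AlgebraicGeometry Literature.AlgebraicGeometry.Motives
open Literature.NumberTheory.Automorphic Literature.NumberTheory.Automorphic.UnitaryGroup
open Literature.NumberTheory.Automorphic.Liu2021.AppendixC (C5.OpenCompactSubgroup C5.SmallLevel)
open Literature.Geometry.ComplexHyperbolic Literature.Geometry.ComplexHyperbolic.BallModel
open Literature.NumberTheory.Automorphic.ShimuraDissection
open Literature.AlgebraicGeometry.ShimuraVarieties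
open Literature.AlgebraicGeometry.ShimuraVarieties.UnitaryCanonicalModel
open Literature.NumberTheory.ComplexMultiplication (traceField traceField_le_fieldRange)

namespace Summit.HodgeConjecture.CorCM.Cruxes.HypDel.ReflexCompositum

/-- **Stub (A) `stub_reflexCompositumModel` of line a1, ASSEMBLED** from (i) the Galois-leg descent over the reflex field `E♯_Φ`
for every CM field `L` and adapted `Φ` (`hGL`, the conclusion of B-plan2's `galoisLegDescentOver_general_of_F1`: an `E♯`-form of
`Sc.Mc` with Shimura reciprocity (62) for `Aut(ℂ/E♯)` in the binder's `L`-idèle convention, `IsCanonicalDescentOver`), (ii) the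
finiteness of the class number of `T₀` (`hg5 = Aux.finite_classGroup_printed`, [BorelIHES1963] Thm. 5.1) and (iii) the existence of
an open compact level of `T₀(𝔸_f)` (`hg6`).  The conclusion is the skeleton's stub (A) VERBATIM: `∃ Φ, ∀ E ⊇ τ(L)·E*(Φ)`, an `E`-form
with (62) for `Aut(ℂ/E)`.  Proof: `Φ` adapted by `Aux.exists_isAdapted`; `E♯ ↪ E` by `Aux.exists_ringHom_reflexField`; tower step
`IsCanonicalDescentOver.tower`. [cite: Deligne1979ShimuraVarieties, 2.2.5 and 2.3.1] [cite: Deligne1971TravauxShimura, Prop. 5.11, Cor. 5.7]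
[cite: Liu2021, App. C Lem. C.14, Rem. C.15] [cite: Milne2005ShimuraVarieties, Def. 12.8 (62) p. 114] -/
theorem stub_reflexCompositumModel_of_galoisLegOver
    (hGL : ∀ (L : Type) [Field L] [NumberField L] [IsCMField L] (H : Matrix (Fin 3) (Fin 3) L) (τ : L →+* ℂ)
      (T : GL (Fin 3) ℂ) (hT : formCongr (starRingEnd ℂ) T (H.map τ) = BallModel.J),
      (∀ τ' : L →+* ℂ, InfinitePlace.mk τ' ≠ InfinitePlace.mk τ → (H.map τ').PosDef) →
      (∀ v : Fin 3 → L, hermForm (cmConjRingHom L) H v v = 0 → v = 0) →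
      ∀ K₀ : C5.OpenCompactSubgroup ↥(finAdelic (↥(maximalRealSubfield L)) L (IsCMField.complexConj L) 3 H),
        (∀ g : finAdelic (↥(maximalRealSubfield L)) L (IsCMField.complexConj L) 3 H,
          ∀ γ ∈ arithmeticLevel (↥(maximalRealSubfield L)) L (IsCMField.complexConj L) 3 H
            (K₀.1.map (MulAut.conj g).toMonoidHom), IsOfFinOrder γ → γ = 1) →
        ∀ (Sc : ComplexRecordSystem L H τ T hT K₀) (Φ : CMType L), Aux.IsAdapted L Φ τ →
          ∀ (L₀ : C5.OpenCompactSubgroup ↥(Aux.torusFinAdelic L)) [Finite (Aux.classGroup L L₀)],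
            ∃ (M : C5.SmallLevel K₀ ⥤ SchemeOver ↥(Aux.reflexField L Φ τ))
              (e' : (M ⋙ Motives.baseChange ↥(Aux.reflexField L Φ τ) ℂ) ≅ Sc.Mc),
              IsCanonicalDescentOver Sc (algebraMap ↥(Aux.reflexField L Φ τ) ℂ) M e')
    (hg5 : Aux.finite_classGroup_printed)
    (hg6 : ∀ (L : Type) [Field L] [NumberField L] [IsCMField L], Nonempty (C5.OpenCompactSubgroup ↥(Aux.torusFinAdelic L))) :
        ∀ (L : Type) [Field L] [NumberField L] [IsCMField L] (H : Matrix (Fin 3) (Fin 3) L) (τ : L →+* ℂ)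
      (T : GL (Fin 3) ℂ) (hT : formCongr (starRingEnd ℂ) T (H.map τ) = BallModel.J),
      (∀ τ' : L →+* ℂ, InfinitePlace.mk τ' ≠ InfinitePlace.mk τ → (H.map τ').PosDef) →
      (∀ v : Fin 3 → L, hermForm (cmConjRingHom L) H v v = 0 → v = 0) →
      ∀ K₀ : C5.OpenCompactSubgroup ↥(finAdelic (↥(maximalRealSubfield L)) L (IsCMField.complexConj L) 3 H),
        (∀ g : finAdelic (↥(maximalRealSubfield L)) L (IsCMField.complexConj L) 3 H,
          ∀ γ ∈ arithmeticLevel (↥(maximalRealSubfield L)) L (IsCMField.complexConj L) 3 H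
            (K₀.1.map (MulAut.conj g).toMonoidHom), IsOfFinOrder γ → γ = 1) →
          ∀ Sc : ComplexRecordSystem L H τ T hT K₀,
            ∃ Φ : CMType L, ∀ (E : Type) [Field E] [NumberField E] (ιE : E →+* ℂ),
              Set.range τ ⊆ Set.range ιE → (traceField Φ : Set ℂ) ⊆ Set.range ιE →
              ∃ (M : C5.SmallLevel K₀ ⥤ SchemeOver E) (e : (M ⋙ baseChangeHom ιE) ≅ Sc.Mc),
              letI : Algebra E ℂ := ιE.toAlgebra
              ∀ (K : C5.SmallLevel K₀) (σ : ℂ ≃ₐ[E] ℂ) (s : (FiniteAdeleRing (𝓞 L) L)ˣ),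
                IsArtinCorrespondent L τ s σ.toRingEquiv →
                ∀ (v₃ : Fin 3 → L) (x : Ball), IsLinePoint L τ T v₃ x →
                  ∀ d : finAdelic (↥(maximalRealSubfield L)) L (IsCMField.complexConj L) 3 H,
                    IsDiagTwist L H v₃ (recipFactor L s) d →
                    ∀ a : finAdelic (↥(maximalRealSubfield L)) L (IsCMField.complexConj L) 3 H,
                      σ • (AlgPoints.baseChangeEquiv ιE (M.obj K)).symm
                          (AlgPoints.map (e.inv.app K) ((Sc.pts K).symm (ShimuraSet.mk L H τ T hT K.1.1 x a))) =
                        (AlgPoints.baseChangeEquiv ιE (M.obj K)).symm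
                          (AlgPoints.map (e.inv.app K)
                            ((Sc.pts K).symm (ShimuraSet.mk L H τ T hT K.1.1 x (d * a)))) := by
  intro L _ _ _ H τ T hT hpos hanis K₀ hneat Sc
  obtain ⟨Φ, hΦ⟩ := Aux.exists_isAdapted L τ
  refine ⟨Φ, ?_⟩
  intro E _ _ ιE hτ hΦE
  obtain ⟨L₀⟩ := hg6 L
  haveI : Finite (Aux.classGroup L L₀) := hg5 L L₀
  obtain ⟨M', e', h'⟩ := hGL L H τ T hT hpos hanis K₀ hneat Sc Φ hΦ L₀
  haveI hcz : CharZero E := inferInstance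
  have key := @Aux.exists_ringHom_reflexField L _ _ Φ τ E _ hcz ιE hτ hΦE
  obtain ⟨j, hj⟩ := key
  have hι : ιE.comp j = algebraMap ↥(Aux.reflexField L Φ τ) ℂ :=
    RingHom.ext fun x => (ιE.comp_apply j x).trans ((hj x).trans (IntermediateField.algebraMap_apply _ x).symm)
  have key2 := IsCanonicalDescentOver.tower Sc j ιE hι M' e' h'
  obtain ⟨M, e, h⟩ := key2
  exact ⟨M, e, h⟩

end Summit.HodgeConjecture.CorCM.Cruxes.HypDel.ReflexCompositum

end
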